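import Summits.Ventures.Crystal3D.Theorems.StickyWulffConstantCoaxialWallLawOffPlane
import HarnessLib

/-!
# The off-plane budget in count form, and `stub_coaxialTwoSlabAdhesion` for fillings with THIN OFF-PLANE cores

HONEST FRAMING. Part of the venture `Summits/Ventures/Crystal3D` (cell `crystal3d-full`), helper
`--supports` the crux `CoaxialWallLaw` (stmt-Ventures-19481, `route-Ventures-StickyWulffConstant`),
REGISTERED line `WallLedgerF` (planner cf-p1 gen 16), open stub `stub_coaxialTwoSlabAdhesion`.
RUNG CREDIT ONLY; F-C1 not moved.  Corollaries of `…CoaxialWallLawOffPlane.coaxialTwoSlabAdhesion_offPlane`: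

* **`coaxialTwoSlabAdhesion_offPlane_count`** — the budget `B′` (off-plane contacts of on-plane window balls) is at
  most `12 · #OFFP`, `OFFP` = the balls of `X` STRICTLY BETWEEN the basal planes of `(L, s₁)` with
  `−R₀−3 ≤ q₂ ≤ h+R₀+3` (double counting + twelve contacts per ball), so
  `cross ≤ D(Y) + (φ₁ + φ₂ − (√6/3) sin θ)πρ² + C(1+h)ρ + 6·#OFFP`.
* **`coaxialTwoSlabAdhesion_of_thinOffPlane`** — for ANY `C_Z`: the stub's inequality (constant `½`) for every
  filling with `#OFFP ≤ C_Z (1+h) ρ` («off-plane cores of bounded cross-section per unit riser length»).  This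
  STRICTLY CONTAINS both the laminar rung (`#OFFP = 0`, `…Laminar`) and the thin-cores statement of the planner
  (`…ThinCores`: few off-SITE balls; every off-plane ball is off-site, not conversely — in-plane disorder of any
  amount is now free of charge).
* **`coaxialTwoSlabAdhesion_thinOffPlane`** — the same in the stub's `∃`-shape (frame re-picked as the witnessed
  one; the height-compatibility and thin-core premises inside).

READING.  For height-compatible co-axial pairs a counterexample to `c₁ = ½` must put `≳ (1+h)ρ` balls STRICTLY
BETWEEN consecutive basal planes near the risers: foreign `{111}` plates, 3D-disordered riser cores.  Height-
incommensurate pairs (every ball of one grain between the other's planes; lit's `T*`) are (F-γ), not covered.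

WHAT THIS IS NOT: the general case; F-C1 not moved.
-/

noncomputable section

namespace Summit.Ventures.Crystal3D.Theorems

open Summit.Ventures.Crystal3D Finset
open Literature.MathematicalPhysics.StatisticalMechanics (fccStacking barlowStacking IsHaggSeq
  contactDeficiency triangularVec₁ triangularVec₂ barlowOffset layerNormal)
open scoped InnerProductSpace

open scoped Classical in
/-- **The off-plane budget, count form.**  See the module docstring. -/
theorem coaxialTwoSlabAdhesion_offPlane_count
    (A₁ : EuclideanSpace ℝ (Fin 3) ≃ₗᵢ[ℝ] EuclideanSpace ℝ (Fin 3)) (t₁ : EuclideanSpace ℝ (Fin 3))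
    (A₂ : EuclideanSpace ℝ (Fin 3) ≃ₗᵢ[ℝ] EuclideanSpace ℝ (Fin 3)) (t₂ : EuclideanSpace ℝ (Fin 3))
    (L : EuclideanSpace ℝ (Fin 3) ≃ₗᵢ[ℝ] EuclideanSpace ℝ (Fin 3)) (s₁ s₂ : EuclideanSpace ℝ (Fin 3))
    {σ σ' : ℤ → ℤ} (hσ : IsHaggSeq σ) (hσ' : IsHaggSeq σ')
    (hsub₁ : (fun p => A₁ p + t₁) '' fccStacking 1 (Real.sqrt (2 / 3)) ⊆
      (fun p => L p + s₁) '' barlowStacking 1 (Real.sqrt (2 / 3)) σ)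
    (hsub₂ : (fun p => A₂ p + t₂) '' fccStacking 1 (Real.sqrt (2 / 3)) ⊆
      (fun p => L p + s₂) '' barlowStacking 1 (Real.sqrt (2 / 3)) σ')
    (hne : (fun p => A₁ p + t₁) '' fccStacking 1 (Real.sqrt (2 / 3)) ≠
      (fun p => A₂ p + t₂) '' fccStacking 1 (Real.sqrt (2 / 3)))
    (hcompat : ∃ k₀ : ℤ, (L.symm (s₂ - s₁)) 2 = k₀ * Real.sqrt (2 / 3)) :
    ∃ C R₀ : ℝ, 1 ≤ R₀ ∧ ∀ h : ℝ, 0 ≤ h → ∀ ρ : ℝ, R₀ ≤ ρ →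
      ∀ X P₁ P₂ : Finset (EuclideanSpace ℝ (Fin 3)),
      (∀ p ∈ X, ∀ q ∈ X, p ≠ q → 1 ≤ dist p q) → P₁ ⊆ X → P₂ ⊆ X \ P₁ →
      (∀ p ∈ X, -(2 * R₀) ≤ p 2 ∧ p 2 ≤ h + 2 * R₀ ∧ p 0 ^ 2 + p 1 ^ 2 ≤ ρ ^ 2) →
      (∀ p, p ∈ P₁ ↔ (p ∈ (fun q => A₁ q + t₁) '' fccStacking 1 (Real.sqrt (2 / 3)) ∧
        -(2 * R₀) ≤ p 2 ∧ p 2 ≤ -R₀ ∧ p 0 ^ 2 + p 1 ^ 2 ≤ ρ ^ 2)) →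
      (∀ p, p ∈ P₂ ↔ (p ∈ (fun q => A₂ q + t₂) '' fccStacking 1 (Real.sqrt (2 / 3)) ∧
        h + R₀ ≤ p 2 ∧ p 2 ≤ h + 2 * R₀ ∧ p 0 ^ 2 + p 1 ^ 2 ≤ ρ ^ 2)) →
      ((((P₁ ×ˢ (X \ P₁)).filter fun pq => dist pq.1 pq.2 = 1).card : ℕ) : ℝ) +
        ((((P₂ ×ˢ ((X \ P₁) \ P₂)).filter fun pq => dist pq.1 pq.2 = 1).card : ℕ) : ℝ) ≤
        contactDeficiency ((X \ P₁) \ P₂) +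
          (Real.sqrt 2 / 4 * ∑ᶠ w ∈ {w ∈ fccStacking 1 (Real.sqrt (2 / 3)) | ‖w‖ = 1},
              |⟪w, A₁.symm (EuclideanSpace.single (2 : Fin 3) (1 : ℝ))⟫_ℝ| +
            Real.sqrt 2 / 4 * ∑ᶠ w ∈ {w ∈ fccStacking 1 (Real.sqrt (2 / 3)) | ‖w‖ = 1},
              |⟪w, A₂.symm (EuclideanSpace.single (2 : Fin 3) (1 : ℝ))⟫_ℝ| -
            (Real.sqrt 6 / 3 : ℝ) * Real.sqrt (1 - ⟪L (EuclideanSpace.single (2 : Fin 3) (1 : ℝ)),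
              (EuclideanSpace.single (2 : Fin 3) (1 : ℝ))⟫_ℝ ^ 2)) * Real.pi * ρ ^ 2 +
          C * (1 + h) * ρ +
          6 * ((X.filter fun q => (-R₀ - 3 ≤ q 2 ∧ q 2 ≤ h + R₀ + 3) ∧
            ¬ ∃ k : ℤ, (L.symm (q - s₁)) 2 = k * Real.sqrt (2 / 3)).card : ℝ) := by
  obtain ⟨C, R₀, hR₀, hmain⟩ := coaxialTwoSlabAdhesion_offPlane A₁ t₁ A₂ t₂ L s₁ s₂ hσ hσ' hsub₁ hsub₂ hne hcompat
  refine ⟨C, R₀, hR₀, ?_⟩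
  intro h hh ρ hρ X P₁ P₂ hX hP₁X hP₂X hcell hP₁ hP₂
  have hfin := hmain h hh ρ hρ X P₁ P₂ hX hP₁X hP₂X hcell hP₁ hP₂
  -- names
  set OnPlane : EuclideanSpace ℝ (Fin 3) → Prop := fun q => ∃ k : ℤ, (L.symm (q - s₁)) 2 = k * Real.sqrt (2 / 3)
    with hOnPlane
  set R := X.filter (fun z => (-R₀ - 2 ≤ z 2 ∧ z 2 ≤ h + R₀ + 2) ∧ OnPlane z) with hR
  set OFF := X.filter (fun q => (-R₀ - 3 ≤ q 2 ∧ q 2 ≤ h + R₀ + 3) ∧ ¬ OnPlane q) with hOFF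
  -- (1) each summand counts off-plane contacts, all of them near the window
  have h1 : ∀ z ∈ R, (X.filter fun q => dist z q = 1 ∧ ¬ OnPlane q).card ≤ (OFF.filter fun q => dist z q = 1).card := by
    intro z hz
    refine card_le_card ?_
    intro q hq
    rw [mem_filter] at hq
    obtain ⟨hqX, hqd, hqns⟩ := hq
    have hzw := (mem_filter.1 hz).2.1
    have hzq : |z 2 - q 2| ≤ 1 := by
      have hsq := dist_sq_eq_three z q
      rw [hqd, one_pow] at hsq
      rw [abs_le]
      constructor <;> nlinarith [sq_nonneg (z 0 - q 0), sq_nonneg (z 1 - q 1), sq_nonneg (z 2 - q 2 - 1),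
        sq_nonneg (z 2 - q 2 + 1)]
    rw [abs_le] at hzq
    rw [mem_filter, hOFF, mem_filter]
    exact ⟨⟨hqX, ⟨by linarith [hzw.1], by linarith [hzw.2]⟩, hqns⟩, hqd⟩
  -- (2) double count
  have h2 : ∑ z ∈ R, (OFF.filter fun q => dist z q = 1).card = ∑ q ∈ OFF, (R.filter fun z => dist z q = 1).card := by
    rw [Finset.sum_congr rfl (fun z _ => Finset.card_filter (fun q => dist z q = 1) OFF), Finset.sum_comm]
    refine sum_congr rfl fun q _ => ?_
    rw [Finset.card_filter]
  -- (3) at most twelve contacts per ball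
  have h3 : ∀ q ∈ OFF, (R.filter fun z => dist z q = 1).card ≤ 12 := by
    intro q hq
    refine le_trans (card_le_card ?_) (card_filter_dist_eq_one_le_twelve X hX q)
    intro z hz
    rw [mem_filter] at hz ⊢
    exact ⟨(mem_filter.1 hz.1).1, by rw [dist_comm]; exact hz.2⟩
  have hB : ∑ z ∈ R, ((X.filter fun q => dist z q = 1 ∧ ¬ OnPlane q).card : ℝ) ≤ 12 * (OFF.card : ℝ) := by
    have hnat : ∑ z ∈ R, (X.filter fun q => dist z q = 1 ∧ ¬ OnPlane q).card ≤ 12 * OFF.card := by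
      calc ∑ z ∈ R, (X.filter fun q => dist z q = 1 ∧ ¬ OnPlane q).card
          ≤ ∑ z ∈ R, (OFF.filter fun q => dist z q = 1).card := sum_le_sum h1
        _ = ∑ q ∈ OFF, (R.filter fun z => dist z q = 1).card := h2
        _ ≤ ∑ q ∈ OFF, 12 := sum_le_sum h3
        _ = 12 * OFF.card := by rw [sum_const, smul_eq_mul, mul_comm]
    have := (Nat.cast_le (α := ℝ)).2 hnat
    push_cast at this
    exact this
  linarith [hfin, hB]

open scoped Classical in
/-- **The stub for fillings with thin OFF-PLANE cores** (explicit height-compatible frame, any `C_Z`).  See the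
module docstring. -/
theorem coaxialTwoSlabAdhesion_of_thinOffPlane
    (A₁ : EuclideanSpace ℝ (Fin 3) ≃ₗᵢ[ℝ] EuclideanSpace ℝ (Fin 3)) (t₁ : EuclideanSpace ℝ (Fin 3))
    (A₂ : EuclideanSpace ℝ (Fin 3) ≃ₗᵢ[ℝ] EuclideanSpace ℝ (Fin 3)) (t₂ : EuclideanSpace ℝ (Fin 3))
    (L : EuclideanSpace ℝ (Fin 3) ≃ₗᵢ[ℝ] EuclideanSpace ℝ (Fin 3)) (s₁ s₂ : EuclideanSpace ℝ (Fin 3))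
    {σ σ' : ℤ → ℤ} (hσ : IsHaggSeq σ) (hσ' : IsHaggSeq σ')
    (hsub₁ : (fun p => A₁ p + t₁) '' fccStacking 1 (Real.sqrt (2 / 3)) ⊆
      (fun p => L p + s₁) '' barlowStacking 1 (Real.sqrt (2 / 3)) σ)
    (hsub₂ : (fun p => A₂ p + t₂) '' fccStacking 1 (Real.sqrt (2 / 3)) ⊆
      (fun p => L p + s₂) '' barlowStacking 1 (Real.sqrt (2 / 3)) σ')
    (hne : (fun p => A₁ p + t₁) '' fccStacking 1 (Real.sqrt (2 / 3)) ≠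
      (fun p => A₂ p + t₂) '' fccStacking 1 (Real.sqrt (2 / 3)))
    (hcompat : ∃ k₀ : ℤ, (L.symm (s₂ - s₁)) 2 = k₀ * Real.sqrt (2 / 3)) (CZ : ℝ) :
    ∃ C R₀ : ℝ, 1 ≤ R₀ ∧ ∀ h : ℝ, 0 ≤ h → ∀ ρ : ℝ, R₀ ≤ ρ →
      ∀ X P₁ P₂ : Finset (EuclideanSpace ℝ (Fin 3)),
      (∀ p ∈ X, ∀ q ∈ X, p ≠ q → 1 ≤ dist p q) → P₁ ⊆ X → P₂ ⊆ X \ P₁ →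
      (∀ p ∈ X, -(2 * R₀) ≤ p 2 ∧ p 2 ≤ h + 2 * R₀ ∧ p 0 ^ 2 + p 1 ^ 2 ≤ ρ ^ 2) →
      (∀ p, p ∈ P₁ ↔ (p ∈ (fun q => A₁ q + t₁) '' fccStacking 1 (Real.sqrt (2 / 3)) ∧
        -(2 * R₀) ≤ p 2 ∧ p 2 ≤ -R₀ ∧ p 0 ^ 2 + p 1 ^ 2 ≤ ρ ^ 2)) →
      (∀ p, p ∈ P₂ ↔ (p ∈ (fun q => A₂ q + t₂) '' fccStacking 1 (Real.sqrt (2 / 3)) ∧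
        h + R₀ ≤ p 2 ∧ p 2 ≤ h + 2 * R₀ ∧ p 0 ^ 2 + p 1 ^ 2 ≤ ρ ^ 2)) →
      (((X.filter fun q => (-R₀ - 3 ≤ q 2 ∧ q 2 ≤ h + R₀ + 3) ∧
          ¬ ∃ k : ℤ, (L.symm (q - s₁)) 2 = k * Real.sqrt (2 / 3)).card : ℝ) ≤ CZ * (1 + h) * ρ) →
      ((((P₁ ×ˢ (X \ P₁)).filter fun pq => dist pq.1 pq.2 = 1).card : ℕ) : ℝ) +
        ((((P₂ ×ˢ ((X \ P₁) \ P₂)).filter fun pq => dist pq.1 pq.2 = 1).card : ℕ) : ℝ) ≤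
        contactDeficiency ((X \ P₁) \ P₂) +
          (Real.sqrt 2 / 4 * ∑ᶠ w ∈ {w ∈ fccStacking 1 (Real.sqrt (2 / 3)) | ‖w‖ = 1},
              |⟪w, A₁.symm (EuclideanSpace.single (2 : Fin 3) (1 : ℝ))⟫_ℝ| +
            Real.sqrt 2 / 4 * ∑ᶠ w ∈ {w ∈ fccStacking 1 (Real.sqrt (2 / 3)) | ‖w‖ = 1},
              |⟪w, A₂.symm (EuclideanSpace.single (2 : Fin 3) (1 : ℝ))⟫_ℝ| -
            (1 / 2 : ℝ) * Real.sqrt (1 - ⟪L (EuclideanSpace.single (2 : Fin 3) (1 : ℝ)),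
              (EuclideanSpace.single (2 : Fin 3) (1 : ℝ))⟫_ℝ ^ 2)) * Real.pi * ρ ^ 2 +
          C * (1 + h) * ρ := by
  obtain ⟨C, R₀, hR₀, hmain⟩ := coaxialTwoSlabAdhesion_offPlane_count A₁ t₁ A₂ t₂ L s₁ s₂ hσ hσ' hsub₁ hsub₂ hne hcompat
  refine ⟨C + 6 * CZ, R₀, hR₀, ?_⟩
  intro h hh ρ hρ X P₁ P₂ hX hP₁X hP₂X hcell hP₁ hP₂ hthin
  have hfin := hmain h hh ρ hρ X P₁ P₂ hX hP₁X hP₂X hcell hP₁ hP₂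
  have hs0 : 0 ≤ Real.sqrt (1 - ⟪L (EuclideanSpace.single (2 : Fin 3) (1 : ℝ)),
      (EuclideanSpace.single (2 : Fin 3) (1 : ℝ))⟫_ℝ ^ 2) := Real.sqrt_nonneg _
  have h6 : (1 / 2 : ℝ) ≤ Real.sqrt 6 / 3 := by
    have h4 : Real.sqrt 4 = 2 := by
      rw [show (4 : ℝ) = 2 ^ 2 by norm_num, Real.sqrt_sq (by norm_num)]
    have h46 : Real.sqrt 4 ≤ Real.sqrt 6 := Real.sqrt_le_sqrt (by norm_num)
    rw [h4] at h46
    linarith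
  have hρ0 : (0 : ℝ) ≤ Real.pi * ρ ^ 2 := by positivity
  have hmono := mul_le_mul_of_nonneg_right h6 (mul_nonneg hs0 hρ0)
  have eC : (C + 6 * CZ) * (1 + h) * ρ = C * (1 + h) * ρ + 6 * (CZ * (1 + h) * ρ) := by ring
  rw [eC]
  nlinarith [hfin, hmono, hthin]

open scoped Classical in
/-- **The stub for fillings with thin off-plane cores — stub shape** (the crux's co-axiality hypothesis as `∃`,
the frame re-picked as the witnessed one, constant `½`), with the height-compatibility and thin-core premises
inside.  See the module docstring. -/
theorem coaxialTwoSlabAdhesion_thinOffPlane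
    (A₁ : EuclideanSpace ℝ (Fin 3) ≃ₗᵢ[ℝ] EuclideanSpace ℝ (Fin 3)) (t₁ : EuclideanSpace ℝ (Fin 3))
    (A₂ : EuclideanSpace ℝ (Fin 3) ≃ₗᵢ[ℝ] EuclideanSpace ℝ (Fin 3)) (t₂ : EuclideanSpace ℝ (Fin 3))
    (hcoax : ∃ (L : EuclideanSpace ℝ (Fin 3) ≃ₗᵢ[ℝ] EuclideanSpace ℝ (Fin 3))
        (s₁ s₂ : EuclideanSpace ℝ (Fin 3)) (σ σ' : ℤ → ℤ), IsHaggSeq σ ∧ IsHaggSeq σ' ∧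
        (fun p => A₁ p + t₁) '' fccStacking 1 (Real.sqrt (2 / 3)) ⊆
          (fun p => L p + s₁) '' barlowStacking 1 (Real.sqrt (2 / 3)) σ ∧
        (fun p => A₂ p + t₂) '' fccStacking 1 (Real.sqrt (2 / 3)) ⊆
          (fun p => L p + s₂) '' barlowStacking 1 (Real.sqrt (2 / 3)) σ')
    (hne : (fun p => A₁ p + t₁) '' fccStacking 1 (Real.sqrt (2 / 3)) ≠
      (fun p => A₂ p + t₂) '' fccStacking 1 (Real.sqrt (2 / 3))) (CZ : ℝ) :
    ∃ (L : EuclideanSpace ℝ (Fin 3) ≃ₗᵢ[ℝ] EuclideanSpace ℝ (Fin 3))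
        (s₁ s₂ : EuclideanSpace ℝ (Fin 3)) (σ σ' : ℤ → ℤ), IsHaggSeq σ ∧ IsHaggSeq σ' ∧
        (fun p => A₁ p + t₁) '' fccStacking 1 (Real.sqrt (2 / 3)) ⊆
          (fun p => L p + s₁) '' barlowStacking 1 (Real.sqrt (2 / 3)) σ ∧
        (fun p => A₂ p + t₂) '' fccStacking 1 (Real.sqrt (2 / 3)) ⊆
          (fun p => L p + s₂) '' barlowStacking 1 (Real.sqrt (2 / 3)) σ' ∧
    ∃ C R₀ : ℝ, 1 ≤ R₀ ∧ ∀ h : ℝ, 0 ≤ h → ∀ ρ : ℝ, R₀ ≤ ρ →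
      ∀ X P₁ P₂ : Finset (EuclideanSpace ℝ (Fin 3)),
      (∀ p ∈ X, ∀ q ∈ X, p ≠ q → 1 ≤ dist p q) → P₁ ⊆ X → P₂ ⊆ X \ P₁ →
      (∀ p ∈ X, -(2 * R₀) ≤ p 2 ∧ p 2 ≤ h + 2 * R₀ ∧ p 0 ^ 2 + p 1 ^ 2 ≤ ρ ^ 2) →
      (∀ p, p ∈ P₁ ↔ (p ∈ (fun q => A₁ q + t₁) '' fccStacking 1 (Real.sqrt (2 / 3)) ∧
        -(2 * R₀) ≤ p 2 ∧ p 2 ≤ -R₀ ∧ p 0 ^ 2 + p 1 ^ 2 ≤ ρ ^ 2)) →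
      (∀ p, p ∈ P₂ ↔ (p ∈ (fun q => A₂ q + t₂) '' fccStacking 1 (Real.sqrt (2 / 3)) ∧
        h + R₀ ≤ p 2 ∧ p 2 ≤ h + 2 * R₀ ∧ p 0 ^ 2 + p 1 ^ 2 ≤ ρ ^ 2)) →
      (∃ k₀ : ℤ, (L.symm (s₂ - s₁)) 2 = k₀ * Real.sqrt (2 / 3)) →
      (((X.filter fun q => (-R₀ - 3 ≤ q 2 ∧ q 2 ≤ h + R₀ + 3) ∧
          ¬ ∃ k : ℤ, (L.symm (q - s₁)) 2 = k * Real.sqrt (2 / 3)).card : ℝ) ≤ CZ * (1 + h) * ρ) →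
      ((((P₁ ×ˢ (X \ P₁)).filter fun pq => dist pq.1 pq.2 = 1).card : ℕ) : ℝ) +
        ((((P₂ ×ˢ ((X \ P₁) \ P₂)).filter fun pq => dist pq.1 pq.2 = 1).card : ℕ) : ℝ) ≤
        contactDeficiency ((X \ P₁) \ P₂) +
          (Real.sqrt 2 / 4 * ∑ᶠ w ∈ {w ∈ fccStacking 1 (Real.sqrt (2 / 3)) | ‖w‖ = 1},
              |⟪w, A₁.symm (EuclideanSpace.single (2 : Fin 3) (1 : ℝ))⟫_ℝ| +
            Real.sqrt 2 / 4 * ∑ᶠ w ∈ {w ∈ fccStacking 1 (Real.sqrt (2 / 3)) | ‖w‖ = 1},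
              |⟪w, A₂.symm (EuclideanSpace.single (2 : Fin 3) (1 : ℝ))⟫_ℝ| -
            (1 / 2 : ℝ) * Real.sqrt (1 - ⟪L (EuclideanSpace.single (2 : Fin 3) (1 : ℝ)),
              (EuclideanSpace.single (2 : Fin 3) (1 : ℝ))⟫_ℝ ^ 2)) * Real.pi * ρ ^ 2 +
          C * (1 + h) * ρ := by
  obtain ⟨L, s₁, s₂, σ, σ', hσ, hσ', hsub₁, hsub₂⟩ := hcoax
  by_cases hcompat : ∃ k₀ : ℤ, (L.symm (s₂ - s₁)) 2 = k₀ * Real.sqrt (2 / 3)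
  · obtain ⟨C, R₀, hR₀, hmain⟩ := coaxialTwoSlabAdhesion_of_thinOffPlane A₁ t₁ A₂ t₂ L s₁ s₂ hσ hσ' hsub₁ hsub₂ hne
      hcompat CZ
    refine ⟨L, s₁, s₂, σ, σ', hσ, hσ', hsub₁, hsub₂, C, R₀, hR₀, ?_⟩
    intro h hh ρ hρ X P₁ P₂ hX hP₁X hP₂X hcell hP₁ hP₂ _ hthin
    exact hmain h hh ρ hρ X P₁ P₂ hX hP₁X hP₂X hcell hP₁ hP₂ hthin
  · refine ⟨L, s₁, s₂, σ, σ', hσ, hσ', hsub₁, hsub₂, 0, 1, le_rfl, ?_⟩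
    intro h hh ρ hρ X P₁ P₂ hX hP₁X hP₂X hcell hP₁ hP₂ hc _
    exact absurd hc hcompat

end Summit.Ventures.Crystal3D.Theorems

end
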